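import Summits.ABC.StewartYu.GenThreeFrameSpecArchWK
import Summits.ABC.StewartYu.ArchG3Schedule
import HarnessLib

/-!
# Cell abc-stewartyu, WP-L.A: the GLUE between the design-B frame (`ArchG3Setup.ArchLevelState`, the record packages,
# `ArchG3Setup.frameOutput_of_schedule`) and the frame spec of the Kummer-carrying induction (`FrameArchWKRat`)

`Summits/ABC/StewartYu/ArchG3FrameGlue.lean` — cell `abc-stewartyu` (HOME `run/shared/lean/pub/abc-stewartyu/`), route
`YuMatveevShapeRat` (rung A1.L, crux r2 `ArchCoreRat`, stmt-ABC-20502), seat p4 (g9, closer), parcel WP-L.A (R27/R29/R31).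
One plain `Prop`-valued definition and theorems; no named fact, no analytic content.

`StartRecordAt C Y n a b A B k₀` is the list of what the START (p1) and the RECORD (p1, `ArchG3Par*`) owe for ONE reduced
rank-`n` datum in lp-1's vocabulary: zero-estimate letters and a slack `Y`; a level schedule `(H, Ŝ, s, U, pv, P, δ₀, wl,
γb, cl, el, N, T, Nh)` with `|Λ/b_{k₀}| ≤ δ₀`, the halving laws, the level-`(0,0)` state `ArchLevelState … 0 (N 0 0) (T 0 0)`
(START), the k-step / half-step / odd-step packages `ArchKStepHypU` / `ArchHalfStepHypU` / `ArchKStepOddHypU` (RECORD),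
the END letters `(D₀, X′, S₀)` with `deg_{Y₀} ≤ D₀` on `U`, `(n+1)X′ ≤ N Ŝ n`, `(n+1)S₀ < T Ŝ n`, and the record
obligations `RecordArchW C Y n A D₀ S₀ X′ (Lb s Ŝ)` of the pivot-weighted induction.  `frameArchWKRat_of_startRecord`:
these, for every reduced 2-independent datum under the negated bound, give `FrameArchWKRat C Y n` (lp-1's ✓
`ArchG3Setup.frameOutput_of_schedule` supplies `FrameOutputTwo`), whence (`archCoreKummer_of_startRecord_two_le_pow`) the
Kummer-conditional core text from `2 ≤ c` and the zero estimate.  The Setup of the frame is THE datum: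
`S := ⟨n, a, _, b, k₀, _⟩` (pivot = the weighted currency's distinguished index).

WHAT THIS IS NOT: no analytic content; no crux moves (the crux needs the Kummer-free `FrameArchW`).

References: Yu. V. Nesterenko, LNM 1819 (2003), §4 Prop. 4.1, §5 (pp. 80–106); E. M. Matveev, Izv. Math. 64 (2000), (1.3).
-/

noncomputable section

open Finset Polynomial
open Literature.NumberTheory.Transcendental
open Literature.NumberTheory.Transcendental.GaGm
open Summit.ABC.StewartYu.ArchSupply (scaledFeldR)

namespace Summit.ABC.StewartYu.ArchG3FrameGlue

open Summit.ABC.StewartYu.GenThreeInductionArchWK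
open Summit.ABC.StewartYu.GenThreeFrameSpecArchW (RecordArchW)
open Summit.ABC.StewartYu.GenThreeFrameSpecArchWK

/-- The frame's Setup IS the datum of the induction (pivot = distinguished index). [folklore] -/
abbrev setupOf (n : ℕ) (a : Fin n → ℚ) (ha : ∀ j, 0 < a j) (b : Fin n → ℤ) (k₀ : Fin n) (hk₀ : b k₀ ≠ 0) : ArchG3Setup :=
  { n := n, α := a, α_pos := ha, b := b, j₀ := k₀, bj₀_ne := hk₀ }

/-- **START + RECORD for one datum, in the frame's vocabulary** (see the module docstring for the list).
[cite: Nesterenko2003, §3.5 (3.23)–(3.24), §4 Prop. 4.1, §5.2 (5.5)–(5.8), (5.21)–(5.22); shape only] -/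
def StartRecordAt (C Y : ℕ → ℝ) (n : ℕ) (a : Fin n → ℚ) (ha : ∀ j, 0 < a j) (b : Fin n → ℤ) (A : Fin n → ℝ)
    (k₀ : Fin n) (hk₀ : b k₀ ≠ 0) : Prop :=
  let S : ArchG3Setup := setupOf n a ha b k₀ hk₀
  ∃ (H Sh : ℕ) (s : Fin S.n → ℕ) (U : Finset (ℕ × (Fin S.n → ℤ))) (pv : ℕ × (Fin S.n → ℤ) → ℤ) (P : ℤ) (δ₀ : ℝ)
    (wl γb : ℕ → ℝ) (cl : ℕ → ℤ) (el : ℕ → Fin S.n → ℤ) (N T : ℕ → ℕ → ℕ) (Nh : ℕ → ℕ) (D₀ X' S₀ : ℕ),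
    |S.Λ / (S.b S.j₀ : ℝ)| ≤ δ₀ ∧
    (∀ lev, wl (lev + 1) = wl lev / 2) ∧ (∀ lev, wl lev / 2 ≤ γb (lev + 1)) ∧
    S.ArchLevelState H Sh s U pv P wl γb cl el 0 (N 0 0) (T 0 0) ∧
    (∀ ν, ν < S.n → S.ArchKStepHypU (fun i => scaledFeldR i.1 H (Sh - 0)) U (S.Lb s 0) P (wl 0) (γb 0) (cl 0) (el 0) δ₀
      (N 0 ν) (N 0 (ν + 1)) (T 0 ν) (T 0 (ν + 1))) ∧
    (∀ lev < Sh, S.ArchHalfStepHypU (fun i => scaledFeldR i.1 H (Sh - lev)) (fun i => scaledFeldR i.1 H (Sh - (lev + 1))) U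
      (S.Lb s lev) P (wl lev) (γb lev) (cl lev) (el lev) (cl (lev + 1)) δ₀ (N lev S.n) (Nh (lev + 1)) (T lev S.n) (T (lev + 1) 0)) ∧
    (∀ lev < Sh, S.ArchKStepOddHypU (fun i => scaledFeldR i.1 H (Sh - (lev + 1))) U (S.Lb s (lev + 1)) P (wl (lev + 1))
      (γb (lev + 1)) (cl (lev + 1)) (el (lev + 1)) δ₀ (Nh (lev + 1)) (N (lev + 1) 1) (T (lev + 1) 0) (T (lev + 1) 1)) ∧
    (∀ lev < Sh, ∀ ν, 1 ≤ ν → ν < S.n → S.ArchKStepHypU (fun i => scaledFeldR i.1 H (Sh - (lev + 1))) U (S.Lb s (lev + 1)) P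
      (wl (lev + 1)) (γb (lev + 1)) (cl (lev + 1)) (el (lev + 1)) δ₀ (N (lev + 1) ν) (N (lev + 1) (ν + 1)) (T (lev + 1) ν)
      (T (lev + 1) (ν + 1))) ∧
    (∀ i ∈ U, i.1 ≤ D₀) ∧ (S.n + 1) * X' ≤ N Sh S.n ∧ (S.n + 1) * S₀ < T Sh S.n ∧
    RecordArchW C Y n A D₀ S₀ X' (S.Lb s Sh)

/-- **THE GLUE**: START + RECORD for every reduced 2-independent rank-`n` datum under the negated bound (and in the regime)
give the frame spec `FrameArchWKRat C Y n` of the Kummer-carrying pivot-weighted induction — the levels are lp-1's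
`ArchG3Setup.frameOutput_of_schedule`. [cite: Nesterenko2003, §4 Prop. 4.1, §5.1 (5.1)–(5.4), pp. 80–97] -/
theorem frameArchWKRat_of_startRecord {C Y : ℕ → ℝ} {n : ℕ} (hn : 1 ≤ n)
    (h : ∀ (a : Fin n → ℚ) (b : Fin n → ℤ) (A : Fin n → ℝ) (B : ℝ) (k₀ : Fin n)
      (ha : ∀ j, 0 < a j),
      (∀ μ : Fin n → ℤ, ∏ j, a j ^ μ j = 1 → μ = 0) →
      (∀ κ : Fin n → ℤ, (∃ γ : ℚ, ∏ j, a j ^ κ j = γ ^ 2) → ∀ j, (2 : ℤ) ∣ κ j) →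
      (∀ T : Finset (Fin n), T.Nonempty → ¬ IsSquare (∏ j ∈ T, a j)) →
      (∀ j, Height.logHeight₁ (a j) ≤ A j) → (∀ j, 1 ≤ A j) →
      (∀ j, b j ≠ 0) → Finset.univ.gcd b = 1 → Monotone A → (∀ j, A j ≤ A k₀) →
      (∀ j, (|b j| : ℝ) * A j ≤ B * A k₀) →
      ¬ -(C n * (∏ j, A j) * Real.log (Real.exp 1 * B)) ≤
          Real.log |∑ j, (b j : ℝ) * Real.log (a j : ℝ)| →
      C n * (∏ j, A j) * Real.log (Real.exp 1 * B) < ∑ j, A j * |(b j : ℝ)| + Real.log 2 →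
      ∀ (hk₀ : b k₀ ≠ 0), StartRecordAt C Y n a ha b A k₀ hk₀) :
    FrameArchWKRat C Y n := by
  intro a b A B k₀ ha hind hK hT hA hA1 hbz hgcd hmono hmax hBw hneg hreg
  have hk₀ : b k₀ ≠ 0 := hbz k₀
  obtain ⟨H, Sh, s, U, pv, P, δ₀, wl, γb, cl, el, N, T, Nh, D₀, X', S₀, hΛ, hwl, hγb, h00, hK0, hH, hO, hKs, hU, hX,
    hS, hrec⟩ := h a b A B k₀ ha hind hK hT hA hA1 hbz hgcd hmono hmax hBw hneg hreg hk₀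
  have hSn : 1 ≤ (setupOf n a ha b k₀ hk₀).n := hn
  have hind' : ∀ T₁ : Finset (Fin (setupOf n a ha b k₀ hk₀).n), T₁.Nonempty →
      ¬ IsSquare (∏ j ∈ T₁, (setupOf n a ha b k₀ hk₀).α j) := hT
  have hout := ArchG3Setup.frameOutput_of_schedule (S := setupOf n a ha b k₀ hk₀) hSn hind' hΛ N T Nh hwl hγb hK0 hH
    hO hKs h00 hU hX hS
  exact ⟨k₀, D₀, S₀, X', (setupOf n a ha b k₀ hk₀).Lb s Sh, hk₀, hout, hrec⟩

/-- **STAGE-1 END-TO-END from START + RECORD**: the crux text `ArchCoreRat` with ONE extra 2-Kummer clause, from `2 ≤ c`,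
the zero estimate, and START + RECORD at every rank `n ≥ 2` for every reduced 2-independent datum under the negated bound.
[cite: Nesterenko2003, Thm 2.2 (p. 55); Matveev2000, Thm 2.1; shape only] -/
theorem archCoreKummer_of_startRecord_two_le_pow {c : ℝ} (hc : 2 ≤ c)
    (h : Nesterenko2003_prop51 → ∀ n, 2 ≤ n → ∃ Y : ℕ → ℝ,
      ∀ (a : Fin n → ℚ) (b : Fin n → ℤ) (A : Fin n → ℝ) (B : ℝ) (k₀ : Fin n) (ha : ∀ j, 0 < a j),
      (∀ μ : Fin n → ℤ, ∏ j, a j ^ μ j = 1 → μ = 0) →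
      (∀ κ : Fin n → ℤ, (∃ γ : ℚ, ∏ j, a j ^ κ j = γ ^ 2) → ∀ j, (2 : ℤ) ∣ κ j) →
      (∀ T : Finset (Fin n), T.Nonempty → ¬ IsSquare (∏ j ∈ T, a j)) →
      (∀ j, Height.logHeight₁ (a j) ≤ A j) → (∀ j, 1 ≤ A j) →
      (∀ j, b j ≠ 0) → Finset.univ.gcd b = 1 → Monotone A → (∀ j, A j ≤ A k₀) →
      (∀ j, (|b j| : ℝ) * A j ≤ B * A k₀) →
      ¬ -((fun r : ℕ => c ^ r) n * (∏ j, A j) * Real.log (Real.exp 1 * B)) ≤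
          Real.log |∑ j, (b j : ℝ) * Real.log (a j : ℝ)| →
      (fun r : ℕ => c ^ r) n * (∏ j, A j) * Real.log (Real.exp 1 * B) < ∑ j, A j * |(b j : ℝ)| + Real.log 2 →
      ∀ (hk₀ : b k₀ ≠ 0), StartRecordAt (fun r => c ^ r) Y n a ha b A k₀ hk₀)
    (hZ : Nesterenko2003_prop51) :
    ∃ c : ℝ, ∀ (r : ℕ) (a : Fin r → ℚ) (b : Fin r → ℤ) (A : Fin r → ℝ) (B : ℝ),
      (∀ i, 0 < a i) →
      (∀ μ : Fin r → ℤ, ∏ i, a i ^ μ i = 1 → μ = 0) →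
      (∀ κ : Fin r → ℤ, (∃ γ : ℚ, ∏ i, a i ^ κ i = γ ^ 2) → ∀ i, (2 : ℤ) ∣ κ i) →
      (∀ i, Height.logHeight₁ (a i) ≤ A i) → (∀ i, 1 ≤ A i) →
      b ≠ 0 → (∀ i, (|b i| : ℝ) ≤ B) →
      -(c ^ r * (∏ i, A i) * Real.log (Real.exp 1 * B)) ≤
        Real.log |∑ i, (b i : ℝ) * Real.log (a i : ℝ)| :=
  archCoreKummer_of_frameWKRat_two_le_pow hc (fun hZ' n hn => by
    obtain ⟨Y, hY⟩ := h hZ' n hn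
    exact ⟨Y, frameArchWKRat_of_startRecord (by omega) hY⟩) hZ

end Summit.ABC.StewartYu.ArchG3FrameGlue

end
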